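import Mathlib.Analysis.SpecialFunctions.Complex.Circle
import Mathlib.Analysis.SpecialFunctions.Trigonometric.Bounds
import Mathlib.Analysis.Real.Pi.Bounds
import HarnessLib

/-!
# Unit-circle toolkit for Konieczny 2020, §4 and §7 (shadowing lemma in multiplicative form)

Topic `Literature/NumberTheory/LFunctions`. Everything in this file is PROVED. The structured
part (§7) of J. Konieczny, *Möbius orthogonality for q-semimultiplicative sequences*, Monatsh.
Math. 192 (2020) is written there for real-valued `q`-semiadditive phases `φ` with `f = e(φ)` and
distances `‖·‖_{ℝ/ℤ}`; we work multiplicatively with unimodular complex numbers and chord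
distances, which are equivalent up to the constants recorded here.  Angles `x : ℝ` enter only
through `e^{ix} = Complex.exp (x * I)`.

* (private restatements of Mathlib's `‖e^{ix} - 1‖ = 2|sin(x/2)| ≤ |x|`) and
  `abs_le_norm_exp_mul_I_sub_one` — Jordan: `(2/π)|x| ≤ ‖e^{ix} - 1‖` for `|x| ≤ π`;
* `exists_arg_repr` — a unimodular `u` is `e^{iψ}` with `|ψ| ≤ π` and `|ψ| ≤ (π/2)‖u - 1‖`;
* `exists_root_near` — if `‖u^q - 1‖ ≤ ε` then `u` is within `(π/2) ε/q` of some `e(c/q)`;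
* `exists_small_root` — a unimodular `u` has an `N`-th root `ξ` with `‖ξ - 1‖ ≤ (π/2)‖u-1‖/N`;
* `norm_pow_sub_pow_le` — `‖a^n - b^n‖ ≤ n‖a - b‖` in the closed unit disc;
* `norm_sub_one_ge_of_pow_eq_one` — a nontrivial `D`-th root of unity `ζ` has `‖ζ - 1‖ ≥ 4/D`;
* `shadowing` — **Lemma 4.2 of the paper** (a quantitative shadowing lemma for `×q` on `ℝ/ℤ`), in
  multiplicative form: if unimodular `θ_l` satisfy `‖θ_{l+1} - θ_l^q‖ ≤ ρ` for `l₀ ≤ l < l₁`, then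
  there is a unimodular `w` with `‖θ_l - w^{q^l}‖ ≤ 4ρ` for all `l₀ ≤ l ≤ l₁`.
-/

noncomputable section

open Complex Real

namespace Literature.NumberTheory.LFunctions

namespace Konieczny

/-! ## Chord length versus angle -/

/-- `‖e^{ix} - 1‖ = 2 |sin(x/2)|` (a restatement of Mathlib's
`Complex.norm_exp_I_mul_ofReal_sub_one`, kept private). [folklore] -/
private theorem norm_exp_mul_I_sub_one (x : ℝ) : ‖Complex.exp (x * I) - 1‖ = 2 * |Real.sin (x / 2)| := by
  have h : Complex.exp (x * I) - 1 = ((Real.cos x - 1 : ℝ) : ℂ) + (Real.sin x : ℝ) * I := by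
    rw [Complex.exp_mul_I, ← Complex.ofReal_cos, ← Complex.ofReal_sin]; push_cast; ring
  rw [h, Complex.norm_add_mul_I]
  have h2 : (Real.cos x - 1) ^ 2 + Real.sin x ^ 2 = (2 * |Real.sin (x / 2)|) ^ 2 := by
    rw [mul_pow, sq_abs, Real.sin_sq (x / 2), Real.cos_sq (x / 2), show 2 * (x / 2) = x by ring]
    linear_combination Real.sin_sq_add_cos_sq x
  rw [h2, Real.sqrt_sq (by positivity)]

/-- `‖e^{ix} - 1‖ ≤ |x|` (cf. Mathlib's `Complex.norm_exp_I_mul_ofReal_sub_one_le`; private).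
[folklore] -/
private theorem norm_exp_mul_I_sub_one_le (x : ℝ) : ‖Complex.exp (x * I) - 1‖ ≤ |x| := by
  rw [norm_exp_mul_I_sub_one]
  have := Real.abs_sin_le_abs (x := x / 2)
  rw [abs_div, abs_two] at this
  linarith

/-- Jordan's inequality in chord form: `(2/π) |x| ≤ ‖e^{ix} - 1‖` for `|x| ≤ π`. [folklore] -/
theorem abs_le_norm_exp_mul_I_sub_one {x : ℝ} (hx : |x| ≤ π) :
    2 / π * |x| ≤ ‖Complex.exp (x * I) - 1‖ := by
  rw [norm_exp_mul_I_sub_one]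
  have hkey : ∀ y : ℝ, 0 ≤ y → y ≤ π → 2 / π * y ≤ 2 * |Real.sin (y / 2)| := by
    intro y hy0 hyπ
    have h := Real.mul_le_sin (x := y / 2) (by linarith) (by linarith)
    have hs : 0 ≤ Real.sin (y / 2) := Real.sin_nonneg_of_nonneg_of_le_pi (by linarith) (by linarith)
    rw [abs_of_nonneg hs]
    linarith
  rcases le_or_gt 0 x with h | h
  · rw [abs_of_nonneg h] at hx ⊢; exact hkey x h hx
  · rw [abs_of_neg h] at hx ⊢
    have := hkey (-x) (by linarith) hx
    rwa [neg_div, Real.sin_neg, abs_neg] at this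

/-- `e^{ix} = 1` when `x = 2πk`. [folklore] -/
theorem exp_real_mul_I_eq_one_of_int {x : ℝ} (k : ℤ) (hx : x = 2 * π * k) :
    Complex.exp (x * I) = 1 := by
  rw [hx]
  push_cast
  rw [show (2 * (π : ℂ) * k) * I = k * (2 * π * I) by ring]
  exact Complex.exp_int_mul_two_pi_mul_I k

/-- A unimodular complex number is `e^{iψ}` with `|ψ| ≤ π` and `|ψ| ≤ (π/2) ‖u - 1‖`.
[folklore] -/
theorem exists_arg_repr {u : ℂ} (hu : ‖u‖ = 1) :
    ∃ ψ : ℝ, |ψ| ≤ π ∧ u = Complex.exp (ψ * I) ∧ |ψ| ≤ π / 2 * ‖u - 1‖ := by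
  have hu' : Complex.exp (arg u * I) = u := by
    have := norm_mul_exp_arg_mul_I u
    rw [hu] at this; simpa using this
  refine ⟨arg u, abs_arg_le_pi u, hu'.symm, ?_⟩
  have h := abs_le_norm_exp_mul_I_sub_one (abs_arg_le_pi u)
  rw [hu'] at h
  have hπ : 0 < π := Real.pi_pos
  rw [div_mul_eq_mul_div, div_le_iff₀ hπ] at h
  nlinarith

/-! ## Roots -/

/-- **Approximate `q`-th roots of unity**: if `u` is unimodular and `‖u^q - 1‖ ≤ ε` then there
is an integer `c` with `‖u - e(c/q)‖ ≤ (π/2) ε / q`. [folklore] -/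
theorem exists_root_near {u : ℂ} (hu : ‖u‖ = 1) {q : ℕ} (hq : 0 < q) :
    ∃ c : ℤ, ‖u - Complex.exp ((2 * π * c / q : ℝ) * I)‖ ≤ π / 2 / q * ‖u ^ q - 1‖ := by
  obtain ⟨ψ, -, hψ, -⟩ := exists_arg_repr hu
  set c : ℤ := round (q * ψ / (2 * π)) with hc
  refine ⟨c, ?_⟩
  set φ : ℝ := q * ψ - 2 * π * c with hφ
  have hπ : 0 < π := Real.pi_pos
  have hqr : (0 : ℝ) < q := by exact_mod_cast hq
  have hφπ : |φ| ≤ π := by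
    have h := abs_sub_round (q * ψ / (2 * π))
    rw [← hc] at h
    have : φ = 2 * π * (q * ψ / (2 * π) - c) := by rw [hφ]; field_simp
    rw [this, abs_mul, abs_of_pos (by positivity : (0 : ℝ) < 2 * π)]
    nlinarith
  -- `u^q = e^{iφ}`
  have huq : u ^ q = Complex.exp (φ * I) := by
    have h1 : u ^ q = Complex.exp (((q * ψ : ℝ) : ℂ) * I) := by
      rw [hψ, ← Complex.exp_nat_mul]; push_cast; ring_nf
    have h2 : (q * ψ : ℝ) = φ + 2 * π * c := by rw [hφ]; ring
    rw [h1, h2]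
    push_cast
    rw [add_mul, Complex.exp_add, show (2 * (π : ℂ) * c) * I = c * (2 * π * I) by ring,
      Complex.exp_int_mul_two_pi_mul_I, mul_one]
  -- `u e(-c/q) = e^{iφ/q}`
  have hueq : u - Complex.exp ((2 * π * c / q : ℝ) * I) =
      Complex.exp ((2 * π * c / q : ℝ) * I) * (Complex.exp ((φ / q : ℝ) * I) - 1) := by
    rw [mul_sub, mul_one, ← Complex.exp_add, hψ]
    congr 2
    have : ψ = 2 * π * c / q + φ / q := by rw [hφ]; field_simp; ring
    conv_lhs => rw [this]
    push_cast; ring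
  rw [hueq, norm_mul, Complex.norm_exp_ofReal_mul_I, one_mul, huq]
  calc ‖Complex.exp ((φ / q : ℝ) * I) - 1‖ ≤ |φ / q| := norm_exp_mul_I_sub_one_le _
    _ = |φ| / q := by rw [abs_div, abs_of_pos hqr]
    _ ≤ (π / 2 * ‖Complex.exp (φ * I) - 1‖) / q := by
        gcongr
        have h := abs_le_norm_exp_mul_I_sub_one hφπ
        rw [div_mul_eq_mul_div, div_le_iff₀ hπ] at h
        nlinarith [norm_nonneg (Complex.exp (φ * I) - 1)]
    _ = π / 2 / q * ‖Complex.exp (φ * I) - 1‖ := by ring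

/-- **Small roots**: a unimodular `u` has an `N`-th root `ξ` (`N ≥ 1`) with `ξ^N = u`, `‖ξ‖ = 1`
and `‖ξ - 1‖ ≤ (π/2) ‖u - 1‖ / N`. [folklore] -/
theorem exists_small_root {u : ℂ} (hu : ‖u‖ = 1) {N : ℕ} (hN : 0 < N) :
    ∃ ξ : ℂ, ‖ξ‖ = 1 ∧ ξ ^ N = u ∧ ‖ξ - 1‖ ≤ π / 2 / N * ‖u - 1‖ := by
  obtain ⟨ψ, -, hψ, hψu⟩ := exists_arg_repr hu
  have hNr : (0 : ℝ) < N := by exact_mod_cast hN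
  refine ⟨Complex.exp ((ψ / N : ℝ) * I), Complex.norm_exp_ofReal_mul_I _, ?_, ?_⟩
  · rw [← Complex.exp_nat_mul, hψ]
    congr 1
    have hNC : (N : ℂ) ≠ 0 := by exact_mod_cast hN.ne'
    push_cast; field_simp
  · calc ‖Complex.exp ((ψ / N : ℝ) * I) - 1‖ ≤ |ψ / N| := norm_exp_mul_I_sub_one_le _
      _ = |ψ| / N := by rw [abs_div, abs_of_pos hNr]
      _ ≤ (π / 2 * ‖u - 1‖) / N := by gcongr
      _ = π / 2 / N * ‖u - 1‖ := by ring

/-- `‖a^n - b^n‖ ≤ n ‖a - b‖` for `‖a‖, ‖b‖ ≤ 1`. [folklore] -/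
theorem norm_pow_sub_pow_le {a b : ℂ} (ha : ‖a‖ ≤ 1) (hb : ‖b‖ ≤ 1) (n : ℕ) :
    ‖a ^ n - b ^ n‖ ≤ n * ‖a - b‖ := by
  induction n with
  | zero => simp
  | succ n ih =>
      have hsplit : a ^ (n + 1) - b ^ (n + 1) = a * (a ^ n - b ^ n) + (a - b) * b ^ n := by ring
      rw [hsplit]
      calc _ ≤ ‖a * (a ^ n - b ^ n)‖ + ‖(a - b) * b ^ n‖ := norm_add_le _ _
        _ = ‖a‖ * ‖a ^ n - b ^ n‖ + ‖a - b‖ * ‖b‖ ^ n := by rw [norm_mul, norm_mul, norm_pow]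
        _ ≤ 1 * (n * ‖a - b‖) + ‖a - b‖ * 1 := by
            gcongr
            exact pow_le_one₀ (norm_nonneg _) hb
        _ = (n + 1 : ℕ) * ‖a - b‖ := by push_cast; ring

/-- **Nontrivial roots of unity are far from `1`**: if `ζ^D = 1`, `ζ ≠ 1` then `‖ζ - 1‖ ≥ 4/D`.
[folklore] -/
theorem norm_sub_one_ge_of_pow_eq_one {ζ : ℂ} {D : ℕ} (hD : 0 < D) (hζD : ζ ^ D = 1)
    (hζ1 : ζ ≠ 1) : 4 / (D : ℝ) ≤ ‖ζ - 1‖ := by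
  have hDr : (0 : ℝ) < D := by exact_mod_cast hD
  have hζn : ‖ζ‖ = 1 := by
    have h : ‖ζ‖ ^ D = 1 := by rw [← norm_pow, hζD, norm_one]
    exact (pow_eq_one_iff_of_nonneg (norm_nonneg _) hD.ne').1 h
  obtain ⟨ψ, hψπ, hψ, -⟩ := exists_arg_repr hζn
  -- `D ψ ∈ 2π ℤ`
  have hDψ : Complex.exp ((D * ψ : ℝ) * I) = 1 := by
    push_cast
    rw [show (D : ℂ) * ψ * I = D * (ψ * I) by ring, Complex.exp_nat_mul, ← hψ, hζD]
  obtain ⟨k, hk⟩ := Complex.exp_eq_one_iff.1 hDψ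
  have hkψ : (D : ℝ) * ψ = k * (2 * π) := by
    have h := congrArg Complex.im hk
    simp at h
    linarith
  have hk0 : k ≠ 0 := by
    rintro rfl
    have : ψ = 0 := by
      have : (D : ℝ) * ψ = 0 := by rw [hkψ]; simp
      rcases mul_eq_zero.1 this with h | h
      · exact absurd h hDr.ne'
      · exact h
    apply hζ1
    rw [hψ, this]; simp
  have hk1 : (1 : ℝ) ≤ |(k : ℝ)| := by
    rw [← Int.cast_abs]; exact_mod_cast Int.one_le_abs hk0
  have hψlow : 2 * π / D ≤ |ψ| := by
    rw [div_le_iff₀ hDr]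
    have : |(D : ℝ) * ψ| = |(k : ℝ)| * (2 * π) := by
      rw [hkψ, abs_mul, abs_of_pos (by positivity : (0 : ℝ) < 2 * π)]
    rw [abs_mul, abs_of_pos hDr] at this
    nlinarith [Real.pi_pos]
  have h := abs_le_norm_exp_mul_I_sub_one hψπ
  rw [← hψ] at h
  calc 4 / (D : ℝ) = 2 / π * (2 * π / D) := by field_simp; ring
    _ ≤ 2 / π * |ψ| := by gcongr
    _ ≤ ‖ζ - 1‖ := h

/-- For unimodular `b`: `‖a * conj b - 1‖ = ‖a - b‖`. [folklore] -/
theorem norm_mul_conj_sub_one {a b : ℂ} (hb : ‖b‖ = 1) :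
    ‖a * (starRingEnd ℂ) b - 1‖ = ‖a - b‖ := by
  have hbb : b * (starRingEnd ℂ) b = 1 := by
    rw [Complex.mul_conj, Complex.normSq_eq_norm_sq, hb]; simp
  have : a * (starRingEnd ℂ) b - 1 = (a - b) * (starRingEnd ℂ) b := by
    rw [sub_mul, hbb]
  rw [this, norm_mul, Complex.norm_conj, hb, mul_one]

/-! ## The shadowing lemma (Lemma 4.2), multiplicative form -/

/-- **Konieczny 2020, Lemma 4.2 (shadowing for `×q`), multiplicative form.**  Let `q ≥ 2` and let
`θ_l` (`l₀ ≤ l ≤ l₁`) be unimodular with `‖θ_{l+1} - θ_l^q‖ ≤ ρ` for `l₀ ≤ l < l₁`.  Then there is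
a unimodular `w` with `‖θ_l - w^{q^l}‖ ≤ 4ρ` for all `l₀ ≤ l ≤ l₁`.  (The paper: for
`‖α_{i+1} - q α_i‖ ≤ ε_i` there is `β` with `‖q^i β - α_i‖ ≪ ε_i`; here `θ_l = e(α_l)`,
`w = e(β)`, constructed from the top down.) [cite: Konieczny2020, Lemma 4.2] -/
theorem shadowing {q : ℕ} (hq : 2 ≤ q) (θ : ℕ → ℂ) (hθ : ∀ l, ‖θ l‖ = 1) {ρ : ℝ} (hρ : 0 ≤ ρ)
    (l₀ l₁ : ℕ) (hl : l₀ ≤ l₁)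
    (hstep : ∀ l, l₀ ≤ l → l < l₁ → ‖θ (l + 1) - θ l ^ q‖ ≤ ρ) :
    ∃ w : ℂ, ‖w‖ = 1 ∧ ∀ l, l₀ ≤ l → l ≤ l₁ → ‖θ l - w ^ q ^ l‖ ≤ 4 * ρ := by
  have hqpos : 0 < q := by omega
  have hqr : (2 : ℝ) ≤ q := by exact_mod_cast hq
  have hqC : (q : ℂ) ≠ 0 := by exact_mod_cast hqpos.ne'
  -- downward induction on `j`, the claim on `[l₁ - j, l₁]`
  suffices H : ∀ j, j ≤ l₁ - l₀ → ∃ w : ℂ, ‖w‖ = 1 ∧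
      ∀ l, l₁ - j ≤ l → l ≤ l₁ → ‖θ l - w ^ q ^ l‖ ≤ 4 * ρ by
    obtain ⟨w, hw, h⟩ := H (l₁ - l₀) le_rfl
    exact ⟨w, hw, fun l hl0 hl1 => h l (by omega) hl1⟩
  intro j
  induction j with
  | zero =>
      intro _
      obtain ⟨ξ, hξ1, hξ, -⟩ := exists_small_root (hθ l₁) (pow_pos hqpos l₁)
      refine ⟨ξ, hξ1, fun l hl hl' => ?_⟩
      have : l = l₁ := by omega
      subst this
      rw [hξ, sub_self, norm_zero]; positivity
  | succ j ih =>
      intro hj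
      obtain ⟨w, hw, hwl⟩ := ih (by omega)
      set l := l₁ - (j + 1) with hldef
      have hl0 : l₀ ≤ l := by omega
      have hl1 : l < l₁ := by omega
      -- `u = w^{q^l} conj θ_l`, `‖u^q - 1‖ ≤ 5ρ`
      set u : ℂ := w ^ q ^ l * (starRingEnd ℂ) (θ l) with hu
      have hu1 : ‖u‖ = 1 := by
        rw [hu, norm_mul, norm_pow, hw, one_pow, Complex.norm_conj, hθ, one_mul]
      have huq : ‖u ^ q - 1‖ ≤ 5 * ρ := by
        have h1 : u ^ q = w ^ q ^ (l + 1) * (starRingEnd ℂ) (θ l ^ q) := by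
          rw [hu, mul_pow, map_pow, ← pow_mul, ← pow_succ]
        rw [h1, norm_mul_conj_sub_one (by rw [norm_pow, hθ, one_pow])]
        calc ‖w ^ q ^ (l + 1) - θ l ^ q‖
            ≤ ‖w ^ q ^ (l + 1) - θ (l + 1)‖ + ‖θ (l + 1) - θ l ^ q‖ :=
              norm_sub_le_norm_sub_add_norm_sub _ _ _
          _ ≤ 4 * ρ + ρ := by
              refine add_le_add ?_ (hstep l hl0 hl1)
              rw [norm_sub_rev]; exact hwl (l + 1) (by omega) (by omega)
          _ = 5 * ρ := by ring
      obtain ⟨c, hc⟩ := exists_root_near hu1 hqpos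
      -- the corrected `w' = w e(-c/q^{l+1})`
      set α : ℝ := 2 * π * c / (q : ℝ) ^ (l + 1) with hα
      set ζ : ℂ := Complex.exp ((-α : ℝ) * I) with hζ
      have hζ1 : ‖ζ‖ = 1 := Complex.norm_exp_ofReal_mul_I _
      have hζpow : ∀ l', l + 1 ≤ l' → ζ ^ q ^ l' = 1 := by
        intro l' hl'
        obtain ⟨d, rfl⟩ := Nat.exists_eq_add_of_le hl'
        rw [hζ, ← Complex.exp_nat_mul]
        have : ((q ^ (l + 1 + d) : ℕ) : ℂ) * ((-α : ℝ) * I) = (((q : ℝ) ^ (l + 1 + d) * -α : ℝ)) * I := by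
          push_cast; ring
        rw [this]
        refine exp_real_mul_I_eq_one_of_int (-(c * (q : ℤ) ^ d)) ?_
        rw [hα, pow_add]
        have hq0 : (q : ℝ) ^ (l + 1) ≠ 0 := pow_ne_zero _ (by positivity)
        push_cast; field_simp
      have hζl : ζ ^ q ^ l = Complex.exp ((-(2 * π * c / q) : ℝ) * I) := by
        rw [hζ, ← Complex.exp_nat_mul]
        congr 1
        rw [hα, pow_succ]
        have hq0 : (q : ℝ) ^ l ≠ 0 := pow_ne_zero _ (by positivity)
        have hq0' : (q : ℝ) ≠ 0 := by positivity
        push_cast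
        field_simp
      refine ⟨w * ζ, by rw [norm_mul, hw, hζ1, one_mul], fun l' hl'0 hl'1 => ?_⟩
      rcases Nat.eq_or_lt_of_le hl'0 with h | h
      · -- `l' = l`
        have hl'l : l' = l := by omega
        rw [hl'l, mul_pow, hζl]
        set Em : ℂ := Complex.exp ((-(2 * π * c / q) : ℝ) * I) with hEm
        set Ep : ℂ := Complex.exp ((2 * π * c / q : ℝ) * I) with hEp
        have hee : Em * Ep = 1 := by
          rw [hEm, hEp, ← Complex.exp_add]
          push_cast
          rw [show -(2 * (π : ℂ) * c / q) * I + 2 * π * c / q * I = 0 by ring, Complex.exp_zero]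
        have hθθ : θ l * (starRingEnd ℂ) (θ l) = 1 := by
          rw [Complex.mul_conj, Complex.normSq_eq_norm_sq, hθ]; simp
        have hid : θ l - w ^ q ^ l * Em = -(θ l * Em) * (u - Ep) := by
          rw [hu]
          linear_combination (w ^ q ^ l * Em) * hθθ - θ l * hee
        rw [hid, norm_mul, norm_neg, norm_mul, hθ, one_mul, hEm, Complex.norm_exp_ofReal_mul_I,
          one_mul]
        refine hc.trans ?_
        calc π / 2 / q * ‖u ^ q - 1‖ ≤ π / 2 / 2 * (5 * ρ) := by gcongr
          _ ≤ 4 * ρ := by nlinarith [Real.pi_lt_d2]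
      · -- `l' ≥ l + 1`: unchanged
        rw [mul_pow, hζpow l' (by omega), mul_one]
        exact hwl l' (by omega) hl'1

end Konieczny

end Literature.NumberTheory.LFunctions
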